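import Literature.Probability.RandomPlanarGeometry.RestrictionMapProofs
import Literature.Probability.RandomPlanarGeometry.RestrictionSides

/-!
# Avoidance determines the law (stmt-CriticalPhenomena-1373): the `*`-hull `A₊ ∪ J₋`

Landing target:
`Summits/CriticalPhenomena/SAWScalingLimit/Theorems/SAWLoopFugacityFlowAvoidanceDeterminesLawStar.lean`
(`--supports stmt-CriticalPhenomena-1373`).

For the two-sided step of the proof of `AvoidanceDeterminesLaw` we need the union `C = X ∪ Y` of
a `+`-hull `X` and a `−`-hull `Y`, disjoint and on the two sides of a configuration `K` of
[LSW]'s `Ω`, to be a `*`-hull whose `±`-parts (`sidePart`, `HullDecomposition`) are `X` and `Y`: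

* `isStarHull_union_of_sides` — `X ∪ Y ∈ 𝒬*` (connectivity of `ℍ ∖ (X ∪ Y)` from the sibling
  file `…Conn`, simple connectivity by Conway VIII.2.2 `Complex.isSimplyConnected_of_compl`);
* `sidePart_union_one`, `sidePart_union_neg_one` — its `+`-part is `X` and its `−`-part is `Y`.
-/

noncomputable section

open scoped Topology
open Filter Set Metric Bornology Complex
open Literature.Probability.RandomPlanarGeometry
open UpperHalfPlane (upperHalfPlaneSet isOpen_upperHalfPlaneSet)

namespace Summit.CriticalPhenomena.SAWScalingLimit.Theorems.AvoidanceDeterminesLaw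

/-- `ℍ ∖ A` is connected for a bounded hull `A` (it is simply connected). [folklore] -/
theorem isConnected_diff_of_isBoundedHull {A : Set ℂ} (hA : IsBoundedHull A) :
    IsConnected (upperHalfPlaneSet \ A) :=
  hA.2.2.isPathConnected.isConnected

/-- The complement of `ℍ ∖ S` is `S ∪ {Im ≤ 0}`. [folklore] -/
theorem compl_diff_eq_union (S : Set ℂ) :
    (upperHalfPlaneSet \ S)ᶜ = S ∪ {z : ℂ | z.im ≤ 0} := by
  ext z
  rw [mem_compl_iff, Set.mem_sdiff, mem_union, not_and, not_not]
  constructor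
  · intro h
    by_cases hz : (0 : ℝ) < z.im
    · exact Or.inl (h hz)
    · exact Or.inr (not_lt.1 hz)
  · rintro (h | h)
    · exact fun _ ↦ h
    · exact fun hz ↦ absurd (show (0 : ℝ) < z.im from hz) (not_lt.2 h)

variable {X Y : Set ℂ}

/-- **`X ∪ Y ∈ 𝒬*`** for a `+`-hull `X` and a `−`-hull `Y`, given the connectivity of
`ℍ ∖ (X ∪ Y)` (in the application `X`, `Y` lie on the two sides of a configuration of `Ω` and
`isConnected_diff_union_of_sides` of the sibling file `…Conn` applies); simple connectivity then
follows from Conway's criterion `Complex.isSimplyConnected_of_compl`. [folklore] -/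
theorem isStarHull_union_of_sides (hX : IsPlusHull X) (hY : IsMinusHull Y)
    (hconn : IsConnected (upperHalfPlaneSet \ (X ∪ Y))) : IsStarHull (X ∪ Y) := by
  have hXb := hX.1.isBoundedHull
  have hYb := hY.1.isBoundedHull
  have hXc : IsClosed X := hXb.isClosed
  have hYc : IsClosed Y := hYb.isClosed
  refine ⟨⟨hXb.1.union hYb.1, ?_, ?_⟩, fun h0 ↦ h0.elim hX.1.zero_notMem hY.1.zero_notMem⟩
  · rw [union_inter_distrib_right, closure_union, hXb.closure_inter_eq, hYb.closure_inter_eq]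
  · -- simple connectivity by Conway's criterion
    have hcompl := compl_diff_eq_union (X ∪ Y)
    have hL : IsConnected ((X ∪ Y) ∪ {z : ℂ | z.im ≤ 0}) := by
      have h1 := hXb.isConnected_union_im_nonpos
      have h2 := hYb.isConnected_union_im_nonpos
      have : (X ∪ Y) ∪ {z : ℂ | z.im ≤ 0} = (X ∪ {z : ℂ | z.im ≤ 0}) ∪ (Y ∪ {z : ℂ | z.im ≤ 0}) := by
        ext z; simp only [mem_union]; tauto
      rw [this]
      exact h1.union ⟨0, Or.inr (by simp), Or.inr (by simp)⟩ h2
    refine Complex.isSimplyConnected_of_compl (isOpen_upperHalfPlaneSet.sdiff (hXc.union hYc)) hconn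
      fun a ha hb ↦ ?_
    rw [hcompl] at ha hb
    have hsub' : {z : ℂ | z.im ≤ 0} ⊆ connectedComponentIn ((X ∪ Y) ∪ {z : ℂ | z.im ≤ 0}) a :=
      subset_union_right.trans (hL.isPreconnected.subset_connectedComponentIn ha subset_rfl)
    obtain ⟨R, hR⟩ := (hb.subset hsub').subset_closedBall 0
    have hmem : (-((|R| + 1 : ℝ) : ℂ) * I) ∈ {z : ℂ | z.im ≤ 0} := by
      show (-((|R| + 1 : ℝ) : ℂ) * I).im ≤ 0
      simp only [neg_mul, neg_im, mul_im, ofReal_re, I_im, mul_one, ofReal_im, I_re, mul_zero, add_zero]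
      linarith [abs_nonneg R]
    have := hR hmem
    rw [mem_closedBall_zero_iff, norm_mul, norm_neg, norm_real, norm_I, mul_one,
      Real.norm_of_nonneg (by positivity)] at this
    linarith [le_abs_self R]

/-- **The `+`-part of `X ∪ Y` is `X`.** [folklore] -/
theorem sidePart_union_one (hX : IsPlusHull X) (hY : IsMinusHull Y) (hXY : Disjoint X Y) :
    sidePart (X ∪ Y) 1 = X := by
  have hXc : IsClosed X := hX.1.isBoundedHull.isClosed
  have hYc : IsClosed Y := hY.1.isBoundedHull.isClosed
  refine Subset.antisymm ?_ ?_
  · rintro a ⟨haC, x, hx, hxa⟩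
    rw [one_mul] at hx
    have hpre : IsPreconnected (connectedComponentIn (X ∪ Y) a) := isPreconnected_connectedComponentIn
    have hsub : connectedComponentIn (X ∪ Y) a ⊆ X ∪ Y := connectedComponentIn_subset _ _
    rcases isPreconnected_iff_subset_of_disjoint_closed.1 hpre X Y hXc hYc hsub
      (by rw [hXY.inter_eq, inter_empty]) with h | h
    · exact h (mem_connectedComponentIn haC)
    · exact absurd (hY.2 x (h hxa)) (not_lt.2 hx.le)
  · intro a haX
    refine ⟨Or.inl haX, ?_⟩
    obtain ⟨x, hx0, hxa⟩ := hX.1.exists_real_mem_connectedComponentIn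
      hX.1.isBoundedHull.isConnected_union_im_nonpos haX
    have hxX : (x : ℂ) ∈ X := connectedComponentIn_subset _ _ hxa
    refine ⟨x, by rw [one_mul]; exact hX.2 x hxX, connectedComponentIn_mono _ subset_union_left hxa⟩

/-- **The `−`-part of `X ∪ Y` is `Y`.** [folklore] -/
theorem sidePart_union_neg_one (hX : IsPlusHull X) (hY : IsMinusHull Y) (hXY : Disjoint X Y) :
    sidePart (X ∪ Y) (-1) = Y := by
  have hXc : IsClosed X := hX.1.isBoundedHull.isClosed
  have hYc : IsClosed Y := hY.1.isBoundedHull.isClosed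
  refine Subset.antisymm ?_ ?_
  · rintro a ⟨haC, x, hx, hxa⟩
    have hx' : x < 0 := by linarith
    have hpre : IsPreconnected (connectedComponentIn (X ∪ Y) a) := isPreconnected_connectedComponentIn
    have hsub : connectedComponentIn (X ∪ Y) a ⊆ X ∪ Y := connectedComponentIn_subset _ _
    rcases isPreconnected_iff_subset_of_disjoint_closed.1 hpre X Y hXc hYc hsub
      (by rw [hXY.inter_eq, inter_empty]) with h | h
    · exact absurd (hX.2 x (h hxa)) (not_lt.2 hx'.le)
    · exact h (mem_connectedComponentIn haC)
  · intro a haY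
    refine ⟨Or.inr haY, ?_⟩
    obtain ⟨x, hx0, hxa⟩ := hY.1.exists_real_mem_connectedComponentIn
      hY.1.isBoundedHull.isConnected_union_im_nonpos haY
    have hxY : (x : ℂ) ∈ Y := connectedComponentIn_subset _ _ hxa
    refine ⟨x, ?_, connectedComponentIn_mono _ subset_union_right hxa⟩
    have := hY.2 x hxY
    linarith

end Summit.CriticalPhenomena.SAWScalingLimit.Theorems.AvoidanceDeterminesLaw

end
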